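import Literature.IUT.HodgeArakelov.PlusMinusTowerCyclicToy

/-!
# The cyclic toy carries [IUTchII] Prop 1.4 / Prop 2.2 data: CLOSED inhabitants of `CohomologySystem`,
# `EtaleThetaData`, `SubgraphDecomposition` (non-vacuity witness, sequel of `PlusMinusTowerCyclicToy.lean`)

S. Mochizuki, *Inter-universal Teichmüller theory II*, kurims manuscript (Dec. 2020), §1 Prop 1.4 p. 27 (the
output `Π_Ÿ(Π)`, `(l·Δ_Θ)(Π)`, `θ(Π) ⊆ H¹(Π_Ÿ(Π), (l·Δ_Θ)(Π))`), §2 Prop 2.2 p. 66 (the decomposition groups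
`Π_{v•} ⊆ Π_{v▶} ⊆ Π^tp_{Y̲_v}` and the inversion `ι`) [claim: Mochizuki2012, status: disputed] (D-0012 claim key;
nothing printed is asserted here).

CONSISTENCY WITNESS, TOY — consistency ≠ faithfulness. Over the CLOSED cyclic toy of
`PlusMinusTowerCyclicToy.lean` (abc-iut-w5-d243; `Π_v := 1`, `G_v := 1`, `k := ℂ`) we inhabit abc-iut-L6-t1's
remaining [IUTchII] §1–§2 INPUT interfaces by degenerate data: `cyclicCohomology` (every `H¹` and the direct
limit the zero group `ℤ/1`), `cyclicEtaleThetaData : EtaleThetaData S S.PiX` (`Π_Ÿ := ⊤ = 1`,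
`(l·Δ_Θ) := 1/1`, orbit `= {0}`, hence `θ = ⊤` by the typed `theta_eq`), `cyclicDecomposition :
SubgraphDecomposition S T D` (`Π_{v•} = Π_{v▶} := ⊤ = 1`, `ι := id`, «corresponds» by the identity).  With
`PlusMinusTowerCyclicToy.lean` this makes the whole INPUT QUINTUPLE `(S, T, D, Dec, W)` of the [IUTchII] §2
discharge files closed-inhabited, so every NV-L6 wave theorem stated «for every `S` / `T` / `W` / `Dec`»
specialises to a closed `Nonempty`.  The degenerate choices say nothing about the genuine objects (the
étale theta class, the tempered coverings); no side taken on [IUTchIII] Cor. 3.12.  abc-iut cell, NV-L6 wave,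
seat abc-iut-w5-d243 («CLAIM NV-L6 EtaleThetaData, CohomologySystem, SubgraphDecomposition»).
[claim: Mochizuki2012, status: disputed] (IUTchII §1 Prop 1.4, kurims p.27)
-/

noncomputable section

namespace Literature.IUT.HodgeArakelov

namespace CyclicToy

universe u

/-! ## 1. A degenerate cohomology system over ANY bundled topological group -/

/-- The ZERO cohomology system over any `P`: every `H¹(·|_J, ·)` and the direct limit are `ℤ/1`, all maps
zero (a closed inhabitant of abc-iut-L6-t1's interface `CohomologySystem P`, for every `P`).
[claim: Mochizuki2012, status: disputed] (IUTchII §1 Prop 1.4, kurims p.27) -/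
@[reducible] def zeroCohomology (P : TopGroup.{u}) : CohomologySystem P where
  H1 _ := PUnit
  res _ := 0
  lim := PUnit
  toLim _ := 0
  toLim_res _ _ := rfl

/-- `CohomologySystem P` is inhabited for every `P`.
[claim: Mochizuki2012, status: disputed] (IUTchII §1 Prop 1.4, kurims p.27) -/
theorem nonempty_cohomologySystem (P : TopGroup.{u}) : Nonempty (CohomologySystem P) :=
  ⟨zeroCohomology P⟩

/-! ## 2. Degenerate étale-theta data over ANY setting, at the reference group itself -/

/-- **Degenerate `EtaleThetaData S S.PiX` for EVERY [IUTchII] §1 setting `S`** (Prop 1.4 output interface):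
`Π_Ÿ(Π) := ⊤` with reference `⊤`, `(l·Δ_Θ)(Π) := 1/1`, zero cohomology, orbit `{0}`, `θ := ⊤` (which IS the
typed `theta_eq` at the zero group). [claim: Mochizuki2012, status: disputed] (IUTchII §1 Prop 1.4, kurims p.27) -/
@[reducible] def degenerateEtaleThetaData (S : ThetaSetting.{u}) : EtaleThetaData S S.PiX where
  isoRef := ⟨ContinuousMulEquiv.refl _⟩
  PiYddRef := ⊤
  PiYdd := ⊤
  isOpen_PiYdd := isOpen_univ
  PiYdd_corresponds e := Subgroup.map_top_of_surjective _ e.surjective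
  lDeltaTheta := ⟨⊥, ⊥, le_rfl, inferInstance⟩
  coh := zeroCohomology S.PiX
  orbit := {0}
  orbit_nonempty := ⟨0, rfl⟩
  theta := Set.univ
  theta_eq := by
    ext b
    exact ⟨fun _ => ⟨0, rfl, Subsingleton.elim _ _⟩, fun _ => Set.mem_univ b⟩

/-- `EtaleThetaData S S.PiX` is inhabited for every setting `S`.
[claim: Mochizuki2012, status: disputed] (IUTchII §1 Prop 1.4, kurims p.27) -/
theorem nonempty_etaleThetaData (S : ThetaSetting.{u}) : Nonempty (EtaleThetaData S S.PiX) :=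
  ⟨degenerateEtaleThetaData S⟩

/-! ## 3. Degenerate subgraph decomposition over ANY bad-place setting and coverings at the reference group -/

/-- **Degenerate `SubgraphDecomposition S T D` for EVERY `S`, `T : TemperedCoverings S S.PiX` and
`D : EtaleThetaData S.toThetaSetting S.PiX`** (Prop 2.2 output interface): `Π_{v•} = Π_{v▶} := ⊥`, references
`⊥`, `ι := id` («corresponds» by the identity and `g := 1`).
[claim: Mochizuki2012, status: disputed] (IUTchII §2 Prop 2.2, kurims p.66) -/
@[reducible] def degenerateDecomposition (S : BadPlaceSetting.{u}) (T : TemperedCoverings S S.PiX)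
    (D : EtaleThetaData S.toThetaSetting S.PiX) : SubgraphDecomposition S T D where
  Pbullet := ⊥
  Ptri := ⊥
  bullet_le_tri := le_rfl
  tri_le_YL := bot_le
  iota := ContinuousMulEquiv.refl _
  iota_bullet := Subgroup.map_id ⊥
  iota_tri := Subgroup.map_id ⊥
  iota_Ydd := Subgroup.map_id _
  refTri := ⊥
  refBullet := ⊥
  corresponds := ⟨ContinuousMulEquiv.refl _, 1, by simp, by simp⟩

/-- `SubgraphDecomposition S T D` is inhabited for every `S`, `T`, `D` at the reference group.
[claim: Mochizuki2012, status: disputed] (IUTchII §2 Prop 2.2, kurims p.66) -/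
theorem nonempty_subgraphDecomposition (S : BadPlaceSetting.{u}) (T : TemperedCoverings S S.PiX)
    (D : EtaleThetaData S.toThetaSetting S.PiX) : Nonempty (SubgraphDecomposition S T D) :=
  ⟨degenerateDecomposition S T D⟩

/-! ## 4. The closed quintuple `(S, T, D, Dec, W)` over the cyclic toy -/

section Closed

variable (l p : ℕ) (hl : l.Prime) (hl2 : l ≠ 2) (hp : p.Prime) (hp2 : p ≠ 2) (hpl : p ≠ l)

/-- CLOSED étale-theta data over the cyclic toy setting.
[claim: Mochizuki2012, status: disputed] (IUTchII §1 Prop 1.4, kurims p.27) -/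
@[reducible] def cyclicEtaleThetaData :
    EtaleThetaData (cyclicBadPlaceSetting l p hl hl2 hp hp2 hpl).toThetaSetting
      (cyclicBadPlaceSetting l p hl hl2 hp hp2 hpl).PiX :=
  degenerateEtaleThetaData _

/-- CLOSED subgraph decomposition over the cyclic toy coverings and étale-theta data.
[claim: Mochizuki2012, status: disputed] (IUTchII §2 Prop 2.2, kurims p.66) -/
@[reducible] def cyclicDecomposition :
    SubgraphDecomposition (cyclicBadPlaceSetting l p hl hl2 hp hp2 hpl) (cyclicCoverings l p hl hl2 hp hp2 hpl)
      (cyclicEtaleThetaData l p hl hl2 hp hp2 hpl) :=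
  degenerateDecomposition _ _ _

/-- **The [IUTchII] §2 input quintuple is closed-inhabited**: at `l := 3`, `p := 5` there exist, in the kernel,
a `BadPlaceSetting` `S`, coverings `T`, étale-theta data `D`, a subgraph decomposition `Dec` and a `±`-tower
`W` over them. [claim: Mochizuki2012, status: disputed] (IUTchII §2 Prop 2.2, kurims p.66) -/
theorem nonempty_quintuple :
    ∃ (S : BadPlaceSetting.{0}) (T : TemperedCoverings S S.PiX) (D : EtaleThetaData S.toThetaSetting S.PiX),
      Nonempty (SubgraphDecomposition S T D) ∧ Nonempty (PlusMinusTower T) :=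
  ⟨cyclicBadPlaceSetting 3 5 Nat.prime_three (by decide) Nat.prime_five (by decide) (by decide),
    cyclicCoverings 3 5 Nat.prime_three (by decide) Nat.prime_five (by decide) (by decide),
    cyclicEtaleThetaData 3 5 Nat.prime_three (by decide) Nat.prime_five (by decide) (by decide),
    ⟨cyclicDecomposition 3 5 Nat.prime_three (by decide) Nat.prime_five (by decide) (by decide)⟩,
    ⟨cyclicTower 3 5 Nat.prime_three (by decide) Nat.prime_five (by decide) (by decide)⟩⟩

end Closed

end CyclicToy

end Literature.IUT.HodgeArakelov

end
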